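import Literature.NumberTheory.Sieve.QuadraticRootsTothWeylSum
import Literature.NumberTheory.Sieve.QuadraticRootsPrimeModuliTothCauchy
import Literature.NumberTheory.Sieve.DivisorBound
import Literature.NumberTheory.Sieve.Polymath8aPartitionOfUnity
import Mathlib.Analysis.SpecialFunctions.SmoothTransition
import Mathlib.Analysis.Calculus.IteratedDeriv.Lemmas
import HarnessLib

/-!
# Tóth's theorem from the Poincaré-series bound (conditional discharge of the positive-discriminant fact)

This module has two parts: (1) the conditional discharge; (2) derivative bounds for the plateau
weights (support material for the analysis of the hypothesis).

## Part 1. The conditional discharge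

Topic `Literature/NumberTheory/Sieve`.  Á. Tóth, *Roots of quadratic congruences*, IMRN 2000
(`toth2000_quadraticRoots_primeModuli` of `PolynomialCongruencesPrimeModuli.lean`: the roots of
an irreducible integer quadratic of positive discriminant are equidistributed to prime moduli) is
proved in the paper by feeding a bound for the Weyl linear forms into the Duke–Friedlander–Iwaniec
sieve.  The tree already has: the sieve (DFI Theorem 5, proved), the reduction of the fact to ONE
h-uniform linear-form bound (`…TothCauchy.toth2000_quadraticRoots_primeModuli_of_uniformLinearFormBound`),
and the arithmetic side of Tóth's method up to the pre-Poisson identity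
(`…TothWeylSum.weylSum_eq_sum_tothSum`: the smoothed Weyl sum is a bounded number of Tóth sums
`½ ∑'_{(α,γ)} W_R(ξ_{(α,γ)}) ψ_R(ξ_{(α,γ)})` over coprime pairs with smooth compactly supported
weights and the Kloosterman phase `e(−hγ̄/α)`, Hooley's identity).

This file closes the loop CONDITIONALLY on the analytic input, stated as a hypothesis (inline, no
new named fact): the **Poincaré-series bound** for the Tóth sums with the plateau weights
`tothPlateau x Y₁` — the estimate T. Ngo proves in arXiv:2107.13301, Proposition 3.18 /
Corollary 3.19 (from Poisson summation and Pitt's bound for sums of Kloosterman sums, Theorem 2.5,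
itself Kuznetsov's formula + the spectral large sieve), in the h-uniform form obtained by keeping
the exact phase of Corollary 3.14 (`…TothWeylSum.weylPhase_factor`) instead of its `O(h/x)`
approximation:

  `‖T_R(x, Y₁, d, h)‖ ≤ K ((h,d)^{1/4} x^{3/4} d^{-1/2} Y₁^{9/4} + x^{1/2} Y₁³) (x d Y₁)^ε`

in Ngo's ranges `2 ≤ Y₁ ≤ x` (so the plateau localises `A' ≍ x`), level `d² ≤ x`, `0 < |h| ≤ C x`
(outside them the trivial bound is used below).

From it: the smoothing (`tothPlateau`, error `≪ (M/Y₁ + 1) x^ε` by `|ρ_h(n)| ≤ C_f τ(n)` and the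
divisor bound), the finiteness of the set of orbit representatives (`repSet`), the choice
`Y₁ = (M/d)^{1/13}` and bookkeeping give the uniform linear-form bound with `θ = 1/13`, `γ = 1/4`
and arbitrarily small `η`, whence **`toth2000_quadraticRoots_primeModuli_of_tothPoincareBound`**.

## References

* Á. Tóth, *Roots of quadratic congruences*, IMRN 2000, no. 14, 719–739. [cite: Toth2000, main theorem]
* T. Ngo, *On roots of quadratic congruences*, arXiv:2107.13301 (Bull. LMS 2024), §3.1 Lemma 3.1
  (smoothing), §3.5 Proposition 3.18, Corollary 3.19 and the proof of Theorem 1.1 (choice of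
  `Y₁`), §2.2 Theorem 2.5 (Pitt). [cite: Ngo2024, §3.1 Lemma 3.1, §3.5 Proposition 3.18–Corollary 3.19]
* W. Duke, J. B. Friedlander, H. Iwaniec, Ann. of Math. (2) 141 (1995), Theorem 5 and §7.
  [cite: DukeFriedlanderIwaniec1995, Theorem 5 p. 437]
-/

noncomputable section

namespace Literature.NumberTheory.Sieve

open scoped MatrixGroups
open Literature.NumberTheory.QuadraticFields.Quadratic (BinQF)
open ModularGroup (T)
open Polynomial Finset

namespace RootForms

/-! ### The plateau weight -/

/-- The smooth plateau `G_{x,Y₁}(t) = ζ((t − (x − x/Y₁)) Y₁/x) · ζ((2x + x/Y₁ − t) Y₁/x)`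
(`ζ = Real.smoothTransition`): `= 1` on `[x, 2x]`, `= 0` off `(x − x/Y₁, 2x + x/Y₁)`, values in
`[0, 1]`. [cite: Ngo2024, §3.1 (the weight `g`)] -/
def tothPlateau (x Y₁ t : ℝ) : ℝ :=
  Real.smoothTransition ((t - (x - x / Y₁)) * (Y₁ / x)) *
    Real.smoothTransition ((2 * x + x / Y₁ - t) * (Y₁ / x))

/-- `0 ≤ G ≤ 1`. [folklore] -/
theorem tothPlateau_nonneg (x Y₁ t : ℝ) : 0 ≤ tothPlateau x Y₁ t :=
  mul_nonneg (Real.smoothTransition.nonneg _) (Real.smoothTransition.nonneg _)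

/-- `0 ≤ G ≤ 1`. [folklore] -/
theorem tothPlateau_le_one (x Y₁ t : ℝ) : tothPlateau x Y₁ t ≤ 1 :=
  mul_le_one₀ (Real.smoothTransition.le_one _) (Real.smoothTransition.nonneg _)
    (Real.smoothTransition.le_one _)

/-- `G = 1` on `[x, 2x]` (`x > 0`, `Y₁ > 0`). [folklore] -/
theorem tothPlateau_eq_one {x Y₁ t : ℝ} (hx : 0 < x) (hY : 0 < Y₁) (h1 : x ≤ t) (h2 : t ≤ 2 * x) :
    tothPlateau x Y₁ t = 1 := by
  have hYx : 0 < Y₁ / x := div_pos hY hx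
  rw [tothPlateau, Real.smoothTransition.one_of_one_le, Real.smoothTransition.one_of_one_le, mul_one]
  · have : x / Y₁ ≤ 2 * x + x / Y₁ - t := by linarith
    calc (1 : ℝ) = x / Y₁ * (Y₁ / x) := by field_simp
      _ ≤ (2 * x + x / Y₁ - t) * (Y₁ / x) := mul_le_mul_of_nonneg_right this hYx.le
  · have : x / Y₁ ≤ t - (x - x / Y₁) := by linarith
    calc (1 : ℝ) = x / Y₁ * (Y₁ / x) := by field_simp
      _ ≤ (t - (x - x / Y₁)) * (Y₁ / x) := mul_le_mul_of_nonneg_right this hYx.le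

/-- `G = 0` for `t ≤ x − x/Y₁`. [folklore] -/
theorem tothPlateau_eq_zero_of_le {x Y₁ t : ℝ} (hx : 0 < x) (hY : 0 < Y₁) (h : t ≤ x - x / Y₁) :
    tothPlateau x Y₁ t = 0 := by
  rw [tothPlateau, Real.smoothTransition.zero_of_nonpos, zero_mul]
  exact mul_nonpos_of_nonpos_of_nonneg (by linarith) (div_pos hY hx).le

/-- `G = 0` for `t ≥ 2x + x/Y₁`. [folklore] -/
theorem tothPlateau_eq_zero_of_ge {x Y₁ t : ℝ} (hx : 0 < x) (hY : 0 < Y₁) (h : 2 * x + x / Y₁ ≤ t) :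
    tothPlateau x Y₁ t = 0 := by
  rw [tothPlateau, Real.smoothTransition.zero_of_nonpos (x := (2 * x + x / Y₁ - t) * (Y₁ / x)),
    mul_zero]
  exact mul_nonpos_of_nonpos_of_nonneg (by linarith) (div_pos hY hx).le

/-- **The plateau differs from the indicator of `(x, 2x]` only on the two edges**, by at most `1`.
[cite: Ngo2024, §3.1 Lemma 3.1 (proof)] -/
theorem abs_indicator_sub_tothPlateau_le {x Y₁ t : ℝ} (hx : 0 < x) (hY : 0 < Y₁) :
    |(Set.Ioc x (2 * x)).indicator (fun _ => (1 : ℝ)) t - tothPlateau x Y₁ t| ≤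
      (Set.Icc (x - x / Y₁) x ∪ Set.Ioc (2 * x) (2 * x + x / Y₁)).indicator (fun _ => (1 : ℝ)) t := by
  have h0 := tothPlateau_nonneg x Y₁ t
  have h1 := tothPlateau_le_one x Y₁ t
  by_cases ht : t ∈ Set.Ioc x (2 * x)
  · rw [Set.indicator_of_mem ht, tothPlateau_eq_one hx hY ht.1.le ht.2, sub_self, abs_zero]
    exact Set.indicator_nonneg (fun _ _ => zero_le_one) _
  · rw [Set.indicator_of_notMem ht, zero_sub, abs_neg, abs_of_nonneg h0]
    rw [Set.mem_Ioc, not_and_or, not_lt, not_le] at ht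
    by_cases hedge : t ∈ Set.Icc (x - x / Y₁) x ∪ Set.Ioc (2 * x) (2 * x + x / Y₁)
    · rw [Set.indicator_of_mem hedge]; exact h1
    · rw [Set.indicator_of_notMem hedge]
      simp only [Set.mem_union, Set.mem_Icc, Set.mem_Ioc, not_or, not_and_or, not_le] at hedge
      rcases ht with ht | ht
      · -- `t ≤ x` and not in the left edge ⇒ `t < x - x/Y₁`
        rcases hedge.1 with h | h
        · exact (tothPlateau_eq_zero_of_le hx hY h.le).le
        · exact absurd ht (not_le.2 h)
      · rcases hedge.2 with h | h
        · exact absurd ht h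
        · exact (tothPlateau_eq_zero_of_ge hx hY h.le).le

/-! ### The finitely many orbit representatives -/

section reps

variable {a b c : ℤ} {d N : ℕ}

/-- A finite left transversal of `Γ₀(q₀)` in `SL₂(ℤ)`. [folklore] -/
theorem exists_finset_leftTransversal (q₀ : ℕ) [NeZero q₀] :
    ∃ Tr : Finset SL(2, ℤ), ∀ ξ : SL(2, ℤ), ∃ t ∈ Tr, ∃ γ ∈ CongruenceSubgroup.Gamma0 q₀, ξ = t * γ := by
  obtain ⟨S, hS, -⟩ := (CongruenceSubgroup.Gamma0 q₀).exists_isComplement_left 1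
  have hfin : S.Finite := by
    apply Set.finite_of_ncard_ne_zero
    rw [hS.ncard_left]
    exact Subgroup.FiniteIndex.index_ne_zero
  refine ⟨hfin.toFinset, fun ξ => ?_⟩
  obtain ⟨⟨s, γ⟩, hsγ, -⟩ := hS.existsUnique ξ
  exact ⟨s.1, hfin.mem_toFinset.2 s.2, γ.1, γ.2, hsγ.symm⟩

/-- **The set of all orbit representatives is finite**: a fixed finite set `repSet` (depending on
`a` and `Δ` only) contains `orbitRep a Q` for every form `Q` of non-square discriminant `Δ`.
[folklore] -/
theorem exists_repSet (a : ℤ) (ha : 0 < a) (Δ : ℤ) (hsq : ¬ IsSquare Δ) :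
    ∃ S : Finset BinQF, ∀ Q : BinQF, Q.disc = Δ → orbitRep a.toNat Q ∈ S := by
  classical
  haveI : NeZero a.toNat := ⟨by omega⟩
  obtain ⟨Tr, hTr⟩ := exists_finset_leftTransversal a.toNat
  refine ⟨(classReps Δ ×ˢ Tr).image (fun p => orbitRep a.toNat (smul p.1 p.2)), fun Q hQ => ?_⟩
  have hQsq : ¬ IsSquare Q.disc := by rw [hQ]; exact hsq
  obtain ⟨hrep, ξ, hξ⟩ := rep_spec hQsq
  rw [hQ] at hrep
  obtain ⟨t, ht, γ, hγ, rfl⟩ := hTr ξ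
  rw [Finset.mem_image]
  refine ⟨(rep Q, t), Finset.mem_product.2 ⟨hrep, ht⟩, ?_⟩
  apply orbitRep_eq_of_levelEquiv
  exact ⟨γ, hγ, by rw [← smul_mul, ← hξ]⟩

/-- The representatives met by a Weyl sum lie in `repSet`. [folklore] -/
theorem image_orbitRep_subset (ha : 0 < a) {S : Finset BinQF}
    (hS : ∀ Q : BinQF, Q.disc = discrim a b c → orbitRep a.toNat Q ∈ S) :
    (levelFormsUpTo a b c d N).image (orbitRep a.toNat) ⊆ S := by
  intro R hR
  obtain ⟨Q, hQ, rfl⟩ := Finset.mem_image.1 hR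
  exact hS Q ((mem_levelFormsUpTo ha).1 hQ).1.disc_eq

end reps

/-! ### Smoothing the linear form -/

section smoothing

variable {a b c : ℤ}

/-- The sharp linear form of DFI as a sum over `n = dm`:
`L_d(M) = ∑_{n ≤ 2dM, d ∣ n, dM < n} ρ_h(n)` for any `N' ≥ 2dM`. [cite: DukeFriedlanderIwaniec1995, p. 425] -/
theorem linearForm_eq_sum_filter (f : ℤ[X]) (h : ℤ) {d : ℕ} (hd : 1 ≤ d) (M : ℝ) (hM : 0 ≤ M)
    {N' : ℕ} (hN' : d * ⌊2 * M⌋₊ ≤ N') :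
    DFI1995.linearForm f h d M =
      ∑ n ∈ (Finset.Icc 1 N').filter (fun n => d ∣ n ∧ (d : ℝ) * M < n ∧ (n : ℝ) ≤ d * (2 * M)),
        polyRootWeylSum f n h := by
  rw [DFI1995.linearForm]
  -- reindex `m ↦ d m`
  refine Finset.sum_nbij' (fun m => d * m) (fun n => n / d) ?_ ?_ ?_ ?_ ?_
  · intro m hm
    simp only [Finset.mem_filter, Finset.mem_Icc] at hm ⊢
    have hd0 : (0 : ℝ) < d := by exact_mod_cast hd
    refine ⟨⟨Nat.one_le_iff_ne_zero.2 (Nat.mul_ne_zero (by omega) (by omega)),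
      le_trans (Nat.mul_le_mul_left d hm.1.2) hN'⟩, dvd_mul_right d m, ?_, ?_⟩
    · push_cast; exact mul_lt_mul_of_pos_left hm.2 hd0
    · push_cast
      have : (m : ℝ) ≤ 2 * M := by
        have := hm.1.2
        have h2 : (m : ℝ) ≤ ⌊2 * M⌋₊ := by exact_mod_cast this
        exact h2.trans (Nat.floor_le (by linarith))
      exact mul_le_mul_of_nonneg_left this hd0.le
  · intro n hn
    simp only [Finset.mem_filter, Finset.mem_Icc] at hn ⊢
    obtain ⟨⟨hn1, -⟩, ⟨k, rfl⟩, hlt, hle⟩ := hn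
    have hd0 : (0 : ℝ) < d := by exact_mod_cast hd
    rw [Nat.mul_div_cancel_left k (by omega)]
    push_cast at hlt hle
    have hk1 : M < k := lt_of_mul_lt_mul_left hlt hd0.le
    have hk2 : (k : ℝ) ≤ 2 * M := le_of_mul_le_mul_left hle hd0
    refine ⟨⟨?_, Nat.le_floor hk2⟩, hk1⟩
    have : (0 : ℝ) < k := hM.trans_lt hk1
    exact_mod_cast this
  · intro m _; simp [Nat.mul_div_cancel_left m (by omega : 0 < d)]
  · intro n hn
    simp only [Finset.mem_filter] at hn
    obtain ⟨-, ⟨k, rfl⟩, -⟩ := hn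
    simp [Nat.mul_div_cancel_left k (by omega : 0 < d)]
  · intro m _; rfl

/-- **Smoothing error**: replacing the indicator of `(dM, 2dM]` by the plateau `G_{x,Y₁}`,
`x = dM`, costs at most the sum of `|ρ_h(n)|` over the two edges.
[cite: Ngo2024, §3.1 Lemma 3.1] -/
theorem norm_linearForm_sub_smooth_le (f : ℤ[X]) (h : ℤ) {d : ℕ} (hd : 1 ≤ d) {M : ℝ} (hM : 1 ≤ M)
    {Y₁ : ℝ} (hY : 1 ≤ Y₁) {N' : ℕ} (hN' : d * ⌊2 * M⌋₊ ≤ N') :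
    ‖DFI1995.linearForm f h d M -
        ∑ n ∈ (Finset.Icc 1 N').filter (d ∣ ·),
          (tothPlateau (d * M) Y₁ n : ℂ) * polyRootWeylSum f n h‖ ≤
      ∑ n ∈ ((Finset.Icc 1 N').filter (d ∣ ·)).filter (fun n : ℕ =>
          (d * M - d * M / Y₁ ≤ (n : ℝ) ∧ (n : ℝ) ≤ d * M) ∨
            (2 * (d * M) < (n : ℝ) ∧ (n : ℝ) ≤ 2 * (d * M) + d * M / Y₁)),
        ‖polyRootWeylSum f n h‖ := by
  have hx : 0 < (d : ℝ) * M := by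
    have : (0 : ℝ) < d := by exact_mod_cast hd
    positivity
  have hY0 : 0 < Y₁ := by linarith
  set S := (Finset.Icc 1 N').filter (d ∣ ·) with hSdef
  -- the sharp sum as an indicator-weighted sum over `S`
  have e1 : DFI1995.linearForm f h d M =
      ∑ n ∈ S, (((Set.Ioc ((d : ℝ) * M) (2 * (d * M))).indicator (fun _ => (1 : ℝ)) (n : ℝ) : ℝ) : ℂ) *
        polyRootWeylSum f n h := by
    rw [linearForm_eq_sum_filter f h hd M (by linarith) hN']
    have hS : (Finset.Icc 1 N').filter (fun n => d ∣ n ∧ (d : ℝ) * M < n ∧ (n : ℝ) ≤ d * (2 * M)) =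
        S.filter (fun n : ℕ => (d : ℝ) * M < n ∧ (n : ℝ) ≤ d * (2 * M)) := by
      ext n; simp only [hSdef, Finset.mem_filter, and_assoc]
    rw [hS, Finset.sum_filter]
    refine Finset.sum_congr rfl fun n _ => ?_
    by_cases hp : (d : ℝ) * M < n ∧ (n : ℝ) ≤ d * (2 * M)
    · rw [if_pos hp, Set.indicator_of_mem (show ((n : ℕ) : ℝ) ∈ Set.Ioc ((d : ℝ) * M) (2 * (d * M))
        from ⟨hp.1, by linarith [hp.2]⟩), Complex.ofReal_one, one_mul]
    · rw [if_neg hp, Set.indicator_of_notMem (show ((n : ℕ) : ℝ) ∉ Set.Ioc ((d : ℝ) * M) (2 * (d * M))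
        from fun hm => hp ⟨hm.1, by linarith [hm.2]⟩)]
      simp
  rw [e1, ← Finset.sum_sub_distrib]
  refine (norm_sum_le _ _).trans ?_
  have e2 : ∑ n ∈ S.filter (fun n : ℕ =>
      (d * M - d * M / Y₁ ≤ (n : ℝ) ∧ (n : ℝ) ≤ d * M) ∨
        (2 * (d * M) < (n : ℝ) ∧ (n : ℝ) ≤ 2 * (d * M) + d * M / Y₁)), ‖polyRootWeylSum f n h‖ =
      ∑ n ∈ S, if (d * M - d * M / Y₁ ≤ (n : ℝ) ∧ (n : ℝ) ≤ d * M) ∨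
        (2 * (d * M) < (n : ℝ) ∧ (n : ℝ) ≤ 2 * (d * M) + d * M / Y₁) then ‖polyRootWeylSum f n h‖
        else 0 := Finset.sum_filter _ _
  rw [e2]
  refine Finset.sum_le_sum fun n _ => ?_
  rw [← sub_mul, norm_mul, ← Complex.ofReal_sub, Complex.norm_real, Real.norm_eq_abs]
  have key := abs_indicator_sub_tothPlateau_le (t := (n : ℝ)) hx hY0
  by_cases he : (d * M - d * M / Y₁ ≤ (n : ℝ) ∧ (n : ℝ) ≤ d * M) ∨
      (2 * (d * M) < (n : ℝ) ∧ (n : ℝ) ≤ 2 * (d * M) + d * M / Y₁)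
  · rw [if_pos he]
    have h1 : |((Set.Ioc ((d : ℝ) * M) (2 * (d * M))).indicator (fun _ => (1 : ℝ)) n) -
        tothPlateau (d * M) Y₁ n| ≤ 1 :=
      key.trans (Set.indicator_apply_le' (fun _ => le_rfl) (fun _ => zero_le_one))
    calc _ ≤ 1 * ‖polyRootWeylSum f n h‖ := mul_le_mul_of_nonneg_right h1 (norm_nonneg _)
      _ = _ := one_mul _
  · rw [if_neg he]
    have h1 : |((Set.Ioc ((d : ℝ) * M) (2 * (d * M))).indicator (fun _ => (1 : ℝ)) n) -
        tothPlateau (d * M) Y₁ n| ≤ 0 := by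
      refine key.trans (le_of_eq ?_)
      apply Set.indicator_of_notMem
      simp only [Set.mem_union, Set.mem_Icc, Set.mem_Ioc]
      exact he
    have h2 := abs_nonneg (((Set.Ioc ((d : ℝ) * M) (2 * (d * M))).indicator (fun _ => (1 : ℝ)) n) -
        tothPlateau (d * M) Y₁ n)
    rw [le_antisymm h1 h2, zero_mul]

end smoothing

/-! ### Irreducible quadratics have non-square discriminant -/

-- (`discrim (-a) (-b) (-c) = discrim a b c` is Mathlib's `discrim_neg`.)

/-- **An irreducible integer quadratic has non-square discriminant** (Gauss's lemma: it is
primitive and irreducible over `ℚ`, hence has no rational root, while a square discriminant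
produces the root `(−b + √Δ)/2a`). [folklore] -/
theorem not_isSquare_discrim_of_irreducible {f : ℤ[X]} (hf : f.natDegree = 2) (hirr : Irreducible f) :
    ¬ IsSquare (discrim (f.coeff 2) (f.coeff 1) (f.coeff 0)) := by
  rintro ⟨k, hk⟩
  set a := f.coeff 2 with ha
  set b := f.coeff 1 with hb
  set c := f.coeff 0 with hc
  have ha0 : a ≠ 0 := by
    rw [ha, ← hf]; exact (leadingCoeff_ne_zero.2 hirr.ne_zero)
  have hprim : f.IsPrimitive := hirr.isPrimitive (by rw [hf]; norm_num)
  have hirrQ : Irreducible (f.map (algebraMap ℤ ℚ)) :=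
    (hprim.irreducible_iff_irreducible_map_fraction_map (K := ℚ)).1 hirr
  have hdegQ : (f.map (algebraMap ℤ ℚ)).natDegree = 2 := by
    rw [natDegree_map_eq_of_injective (algebraMap ℤ ℚ).injective_int, hf]
  have hroots : (f.map (algebraMap ℤ ℚ)).roots = 0 :=
    (irreducible_iff_roots_eq_zero_of_degree_le_three (by rw [hdegQ]) (by rw [hdegQ]; norm_num)).1 hirrQ
  -- the rational root
  set r : ℚ := (-(b : ℚ) + k) / (2 * a) with hr
  have hfq : f.map (algebraMap ℤ ℚ) = Polynomial.C (a : ℚ) * X ^ 2 + Polynomial.C (b : ℚ) * X + Polynomial.C (c : ℚ) := by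
    conv_lhs => rw [← eq_quad_of_natDegree_le_two f (by rw [hf])]
    simp [ha, hb, hc]
  have hroot : (f.map (algebraMap ℤ ℚ)).IsRoot r := by
    rw [IsRoot, hfq]
    simp only [eval_add, eval_mul, eval_C, eval_pow, eval_X]
    have haQ : (a : ℚ) ≠ 0 := by exact_mod_cast ha0
    have hΔ : discrim (a : ℚ) b c = (k : ℚ) * k := by
      have : ((discrim a b c : ℤ) : ℚ) = ((k * k : ℤ) : ℚ) := by rw [hk]
      push_cast at this
      rw [← this]; simp [discrim]
    have := (quadratic_eq_zero_iff haQ hΔ r).2 (Or.inl hr)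
    linear_combination this
  have hmem : r ∈ (f.map (algebraMap ℤ ℚ)).roots := by
    rw [mem_roots (hirrQ.ne_zero)]; exact hroot
  rw [hroots] at hmem
  simp at hmem

/-! ### Counting and bounding the smoothing edges -/

/-- Naturals in a real interval `[u, v]` (`u ≤ v`): at most `v − u + 1`. [folklore] -/
theorem card_filter_real_Icc_le (S : Finset ℕ) {u v : ℝ} (huv : u ≤ v) :
    ((S.filter (fun m : ℕ => u ≤ (m : ℝ) ∧ (m : ℝ) ≤ v)).card : ℝ) ≤ v - u + 1 := by
  have hsub : S.filter (fun m : ℕ => u ≤ (m : ℝ) ∧ (m : ℝ) ≤ v) ⊆ Finset.Icc ⌈u⌉₊ ⌊v⌋₊ := by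
    intro m hm
    rw [Finset.mem_filter] at hm
    rw [Finset.mem_Icc]
    exact ⟨Nat.ceil_le.2 hm.2.1, Nat.le_floor hm.2.2⟩
  have hv0 : 0 ≤ v ∨ v < 0 := le_or_gt 0 v
  calc (((S.filter (fun m : ℕ => u ≤ (m : ℝ) ∧ (m : ℝ) ≤ v)).card : ℕ) : ℝ)
      ≤ ((Finset.Icc ⌈u⌉₊ ⌊v⌋₊).card : ℝ) := by exact_mod_cast Finset.card_le_card hsub
    _ = ((⌊v⌋₊ + 1 - ⌈u⌉₊ : ℕ) : ℝ) := by rw [Nat.card_Icc]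
    _ ≤ v - u + 1 := by
        rcases le_or_gt ⌈u⌉₊ (⌊v⌋₊ + 1) with h | h
        · rw [Nat.cast_sub h]
          push_cast
          rcases hv0 with hv | hv
          · have h1 : (⌊v⌋₊ : ℝ) ≤ v := Nat.floor_le hv
            have h2 : u ≤ ⌈u⌉₊ := Nat.le_ceil u
            linarith
          · have : ⌊v⌋₊ = 0 := Nat.floor_eq_zero.2 (by linarith)
            rw [this]
            have h2 : u ≤ ⌈u⌉₊ := Nat.le_ceil u
            have h3 : (0 : ℝ) ≤ ⌈u⌉₊ := Nat.cast_nonneg _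
            push_cast
            linarith
        · rw [Nat.sub_eq_zero_of_le h.le]
          push_cast
          linarith

/-- **The edge sum**: with `|ρ_h(n)| ≤ C_ρ τ(n)` and `τ(n) ≤ C_τ n^{ε₀}`, the sum of `|ρ_h(n)|` over
the multiples of `d` in the two edges of the plateau is
`≤ 2(M/Y₁ + 1) · C_ρ C_τ (3dM)^{ε₀}`. [cite: Ngo2024, §3.1 Lemma 3.1] -/
theorem edge_sum_le {ρ : ℕ → ℂ} {Cρ Cτ ε₀ : ℝ} (hCρ : 0 ≤ Cρ) (hCτ : 0 ≤ Cτ) (hε₀ : 0 ≤ ε₀)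
    (hρ : ∀ n : ℕ, 1 ≤ n → ‖ρ n‖ ≤ Cρ * (Nat.divisors n).card)
    (hτ : ∀ n : ℕ, n ≠ 0 → ((Nat.divisors n).card : ℝ) ≤ Cτ * (n : ℝ) ^ ε₀)
    {d : ℕ} (hd : 1 ≤ d) {M : ℝ} (hM : 1 ≤ M) {Y₁ : ℝ} (hY : 1 ≤ Y₁) (N' : ℕ) :
    ∑ n ∈ ((Finset.Icc 1 N').filter (d ∣ ·)).filter (fun n : ℕ =>
        (d * M - d * M / Y₁ ≤ (n : ℝ) ∧ (n : ℝ) ≤ d * M) ∨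
          (2 * (d * M) < (n : ℝ) ∧ (n : ℝ) ≤ 2 * (d * M) + d * M / Y₁)), ‖ρ n‖ ≤
      2 * (M / Y₁ + 1) * (Cρ * Cτ * (3 * d * M) ^ ε₀) := by
  have hd0 : (0 : ℝ) < d := by exact_mod_cast hd
  have hY0 : 0 < Y₁ := by linarith
  have hMY : 0 ≤ M / Y₁ := by positivity
  have hMY' : M / Y₁ ≤ M := div_le_self (by linarith) hY
  set E := ((Finset.Icc 1 N').filter (d ∣ ·)).filter (fun n : ℕ =>
        (d * M - d * M / Y₁ ≤ (n : ℝ) ∧ (n : ℝ) ≤ d * M) ∨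
          (2 * (d * M) < (n : ℝ) ∧ (n : ℝ) ≤ 2 * (d * M) + d * M / Y₁)) with hE
  -- each term
  have hterm : ∀ n ∈ E, ‖ρ n‖ ≤ Cρ * Cτ * (3 * d * M) ^ ε₀ := by
    intro n hn
    rw [hE, Finset.mem_filter, Finset.mem_filter, Finset.mem_Icc] at hn
    obtain ⟨⟨⟨hn1, -⟩, -⟩, hedge⟩ := hn
    have hdMY : (d : ℝ) * M / Y₁ ≤ d * M := div_le_self (by positivity) hY
    have hdM0 : (0 : ℝ) ≤ d * M := by positivity
    have hnle : (n : ℝ) ≤ 3 * d * M := by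
      rcases hedge with ⟨-, h⟩ | ⟨-, h⟩
      · linarith
      · linarith
    calc ‖ρ n‖ ≤ Cρ * (Nat.divisors n).card := hρ n hn1
      _ ≤ Cρ * (Cτ * (n : ℝ) ^ ε₀) := mul_le_mul_of_nonneg_left (hτ n (by omega)) hCρ
      _ ≤ Cρ * (Cτ * (3 * d * M) ^ ε₀) := by
          apply mul_le_mul_of_nonneg_left _ hCρ
          exact mul_le_mul_of_nonneg_left (Real.rpow_le_rpow (Nat.cast_nonneg _) hnle hε₀) hCτ
      _ = Cρ * Cτ * (3 * d * M) ^ ε₀ := by ring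
  -- the number of terms: `E ⊆ d · (M₁ ∪ M₂)`
  set M₁ := (Finset.Icc 1 N').filter (fun m : ℕ => M - M / Y₁ ≤ (m : ℝ) ∧ (m : ℝ) ≤ M) with hM₁
  set M₂ := (Finset.Icc 1 N').filter (fun m : ℕ => 2 * M ≤ (m : ℝ) ∧ (m : ℝ) ≤ 2 * M + M / Y₁) with hM₂
  have hEsub : E ⊆ (M₁ ∪ M₂).image (fun m => d * m) := by
    intro n hn
    rw [hE, Finset.mem_filter, Finset.mem_filter, Finset.mem_Icc] at hn
    obtain ⟨⟨⟨hn1, hnN⟩, ⟨m, rfl⟩⟩, hedge⟩ := hn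
    rw [Finset.mem_image]
    refine ⟨m, ?_, rfl⟩
    have hm1 : 1 ≤ m := by
      rcases Nat.eq_zero_or_pos m with rfl | h
      · simp at hn1
      · exact h
    have hmN : m ≤ N' := le_trans (Nat.le_mul_of_pos_left m (by omega)) hnN
    push_cast at hedge
    rw [Finset.mem_union, hM₁, hM₂, Finset.mem_filter, Finset.mem_filter, Finset.mem_Icc]
    have e1 : (d : ℝ) * (M - M / Y₁) = d * M - d * M / Y₁ := by ring
    have e2 : (d : ℝ) * (2 * M + M / Y₁) = 2 * (d * M) + d * M / Y₁ := by ring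
    have e3 : (d : ℝ) * (2 * M) = 2 * (d * M) := by ring
    rcases hedge with ⟨h1, h2⟩ | ⟨h1, h2⟩
    · left
      refine ⟨⟨hm1, hmN⟩, ?_, ?_⟩
      · have : (d : ℝ) * (M - M / Y₁) ≤ d * m := by rw [e1]; exact h1
        exact le_of_mul_le_mul_left this hd0
      · exact le_of_mul_le_mul_left h2 hd0
    · right
      refine ⟨⟨hm1, hmN⟩, ?_, ?_⟩
      · have : (d : ℝ) * (2 * M) ≤ d * m := by rw [e3]; exact h1.le
        exact le_of_mul_le_mul_left this hd0
      · have : (d : ℝ) * m ≤ d * (2 * M + M / Y₁) := by rw [e2]; exact h2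
        exact le_of_mul_le_mul_left this hd0
  have hcard : (E.card : ℝ) ≤ 2 * (M / Y₁ + 1) := by
    have h1 : E.card ≤ (M₁ ∪ M₂).card :=
      (Finset.card_le_card hEsub).trans Finset.card_image_le
    have h2 : (M₁ ∪ M₂).card ≤ M₁.card + M₂.card := Finset.card_union_le _ _
    have h3 : (M₁.card : ℝ) ≤ M - (M - M / Y₁) + 1 := card_filter_real_Icc_le _ (by linarith)
    have h4 : (M₂.card : ℝ) ≤ (2 * M + M / Y₁) - 2 * M + 1 := card_filter_real_Icc_le _ (by linarith)
    have h12 : (E.card : ℝ) ≤ M₁.card + M₂.card := by exact_mod_cast h1.trans h2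
    linarith
  calc ∑ n ∈ E, ‖ρ n‖ ≤ ∑ n ∈ E, Cρ * Cτ * (3 * d * M) ^ ε₀ := Finset.sum_le_sum hterm
    _ = E.card * (Cρ * Cτ * (3 * d * M) ^ ε₀) := by rw [Finset.sum_const, nsmul_eq_mul]
    _ ≤ 2 * (M / Y₁ + 1) * (Cρ * Cτ * (3 * d * M) ^ ε₀) := by
        apply mul_le_mul_of_nonneg_right hcard; positivity

/-- The trivial bound for the sharp linear form: `‖L_d(M)‖ ≤ 2M · C_ρ C_τ (2dM)^{ε₀}`. [folklore] -/
theorem norm_linearForm_le_trivial {f : ℤ[X]} {h : ℤ} {Cρ Cτ ε₀ : ℝ} (hCρ : 0 ≤ Cρ) (hCτ : 0 ≤ Cτ)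
    (hε₀ : 0 ≤ ε₀)
    (hρ : ∀ n : ℕ, 1 ≤ n → ‖polyRootWeylSum f n h‖ ≤ Cρ * (Nat.divisors n).card)
    (hτ : ∀ n : ℕ, n ≠ 0 → ((Nat.divisors n).card : ℝ) ≤ Cτ * (n : ℝ) ^ ε₀)
    {d : ℕ} (hd : 1 ≤ d) {M : ℝ} (hM : 1 ≤ M) :
    ‖DFI1995.linearForm f h d M‖ ≤ 2 * M * (Cρ * Cτ * (2 * d * M) ^ ε₀) := by
  have hd0 : (0 : ℝ) < d := by exact_mod_cast hd
  rw [DFI1995.linearForm]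
  refine (norm_sum_le _ _).trans ?_
  have hterm : ∀ m ∈ (Finset.Icc 1 ⌊2 * M⌋₊).filter (fun m : ℕ => M < (m : ℝ)),
      ‖polyRootWeylSum f (d * m) h‖ ≤ Cρ * Cτ * (2 * d * M) ^ ε₀ := by
    intro m hm
    rw [Finset.mem_filter, Finset.mem_Icc] at hm
    have hm2 : (m : ℝ) ≤ 2 * M := (Nat.le_floor_iff (by linarith)).1 hm.1.2 |> fun h => by exact_mod_cast h
    have hdm1 : 1 ≤ d * m := Nat.one_le_iff_ne_zero.2 (Nat.mul_ne_zero (by omega) (by omega))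
    calc ‖polyRootWeylSum f (d * m) h‖ ≤ Cρ * (Nat.divisors (d * m)).card := hρ _ hdm1
      _ ≤ Cρ * (Cτ * ((d * m : ℕ) : ℝ) ^ ε₀) := mul_le_mul_of_nonneg_left (hτ _ (by omega)) hCρ
      _ ≤ Cρ * (Cτ * (2 * d * M) ^ ε₀) := by
          apply mul_le_mul_of_nonneg_left _ hCρ
          apply mul_le_mul_of_nonneg_left _ hCτ
          apply Real.rpow_le_rpow (Nat.cast_nonneg _) _ hε₀
          push_cast; nlinarith
      _ = Cρ * Cτ * (2 * d * M) ^ ε₀ := by ring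
  calc ∑ m ∈ (Finset.Icc 1 ⌊2 * M⌋₊).filter (fun m : ℕ => M < (m : ℝ)), ‖polyRootWeylSum f (d * m) h‖
      ≤ ∑ m ∈ (Finset.Icc 1 ⌊2 * M⌋₊).filter (fun m : ℕ => M < (m : ℝ)), Cρ * Cτ * (2 * d * M) ^ ε₀ :=
        Finset.sum_le_sum hterm
    _ = ((Finset.Icc 1 ⌊2 * M⌋₊).filter (fun m : ℕ => M < (m : ℝ))).card * (Cρ * Cτ * (2 * d * M) ^ ε₀) := by
        rw [Finset.sum_const, nsmul_eq_mul]
    _ ≤ 2 * M * (Cρ * Cτ * (2 * d * M) ^ ε₀) := by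
        apply mul_le_mul_of_nonneg_right _ (by positivity)
        have h1 : ((Finset.Icc 1 ⌊2 * M⌋₊).filter (fun m : ℕ => M < (m : ℝ))).card ≤ ⌊2 * M⌋₊ :=
          (Finset.card_filter_le _ _).trans (by simp)
        have h2 : (⌊2 * M⌋₊ : ℝ) ≤ 2 * M := Nat.floor_le (by linarith)
        calc (((Finset.Icc 1 ⌊2 * M⌋₊).filter (fun m : ℕ => M < (m : ℝ))).card : ℝ) ≤ ⌊2 * M⌋₊ := by
              exact_mod_cast h1
          _ ≤ 2 * M := h2

/-! ### Power bookkeeping for `Y₁ = (M/d)^{1/13}` -/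

section powers

variable {d M : ℝ}

/-- `M / M^{1/13} = M^{12/13}`. [folklore] -/
theorem self_div_rpow13 (hM : 0 < M) : M / M ^ (1 / 13 : ℝ) = M ^ (12 / 13 : ℝ) := by
  have h := Real.rpow_sub hM 1 (1 / 13)
  rw [Real.rpow_one] at h
  rw [← h]; norm_num

/-- `x^{3/4} d^{-1/2} Y₁^{9/4} = d^{1/13} M^{12/13}` for `x = dM`, `Y₁ = (M/d)^{1/13}`. [cite: Ngo2024, proof of Theorem 1.1 (choice of `Y₁`)] -/
theorem main_term_one (hd : 0 < d) (hM : 0 < M) :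
    (d * M) ^ (3 / 4 : ℝ) * d ^ (-(1 / 2) : ℝ) * ((M / d) ^ (1 / 13 : ℝ)) ^ (9 / 4 : ℝ) =
      d ^ (1 / 13 : ℝ) * M ^ (12 / 13 : ℝ) := by
  have hMd : 0 ≤ M / d := (div_pos hM hd).le
  have h1 : (d * M) ^ (3 / 4 : ℝ) = d ^ (3 / 4 : ℝ) * M ^ (3 / 4 : ℝ) := Real.mul_rpow hd.le hM.le
  have h2 : ((M / d) ^ (1 / 13 : ℝ)) ^ (9 / 4 : ℝ) = (M / d) ^ (9 / 52 : ℝ) := by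
    rw [← Real.rpow_mul hMd]; norm_num
  have h3 : (M / d) ^ (9 / 52 : ℝ) = M ^ (9 / 52 : ℝ) / d ^ (9 / 52 : ℝ) := Real.div_rpow hM.le hd.le _
  have ed : d ^ (3 / 4 : ℝ) * d ^ (-(1 / 2) : ℝ) / d ^ (9 / 52 : ℝ) = d ^ (1 / 13 : ℝ) := by
    rw [← Real.rpow_add hd, ← Real.rpow_sub hd]; norm_num
  have eM : M ^ (3 / 4 : ℝ) * M ^ (9 / 52 : ℝ) = M ^ (12 / 13 : ℝ) := by
    rw [← Real.rpow_add hM]; norm_num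
  rw [h1, h2, h3]
  calc d ^ (3 / 4 : ℝ) * M ^ (3 / 4 : ℝ) * d ^ (-(1 / 2) : ℝ) * (M ^ (9 / 52 : ℝ) / d ^ (9 / 52 : ℝ))
      = (d ^ (3 / 4 : ℝ) * d ^ (-(1 / 2) : ℝ) / d ^ (9 / 52 : ℝ)) * (M ^ (3 / 4 : ℝ) * M ^ (9 / 52 : ℝ)) := by
        ring
    _ = d ^ (1 / 13 : ℝ) * M ^ (12 / 13 : ℝ) := by rw [ed, eM]

/-- `x^{1/2} Y₁³ ≤ d^{1/13} M^{12/13}` for `x = dM`, `Y₁ = (M/d)^{1/13}`, `0 < d ≤ M`. [cite: Ngo2024, proof of Theorem 1.1] -/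
theorem main_term_two (hd : 0 < d) (hdM : d ≤ M) :
    (d * M) ^ (1 / 2 : ℝ) * ((M / d) ^ (1 / 13 : ℝ)) ^ (3 : ℝ) ≤ d ^ (1 / 13 : ℝ) * M ^ (12 / 13 : ℝ) := by
  have hM : 0 < M := hd.trans_le hdM
  have hMd : 0 ≤ M / d := (div_pos hM hd).le
  have h1 : (d * M) ^ (1 / 2 : ℝ) = d ^ (1 / 2 : ℝ) * M ^ (1 / 2 : ℝ) := Real.mul_rpow hd.le hM.le
  have h2 : ((M / d) ^ (1 / 13 : ℝ)) ^ (3 : ℝ) = (M / d) ^ (3 / 13 : ℝ) := by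
    rw [← Real.rpow_mul hMd]; norm_num
  have h3 : (M / d) ^ (3 / 13 : ℝ) = M ^ (3 / 13 : ℝ) / d ^ (3 / 13 : ℝ) := Real.div_rpow hM.le hd.le _
  -- `d^{1/2}/d^{3/13} = d^{1/13} d^{5/26}` and `M^{1/2} M^{3/13} = M^{12/13} / M^{5/26}`
  have ed : d ^ (1 / 2 : ℝ) / d ^ (3 / 13 : ℝ) = d ^ (1 / 13 : ℝ) * d ^ (5 / 26 : ℝ) := by
    rw [← Real.rpow_sub hd, ← Real.rpow_add hd]; norm_num
  have eM : M ^ (1 / 2 : ℝ) * M ^ (3 / 13 : ℝ) = M ^ (12 / 13 : ℝ) / M ^ (5 / 26 : ℝ) := by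
    rw [← Real.rpow_add hM, ← Real.rpow_sub hM]; norm_num
  have hd3 : d ^ (3 / 13 : ℝ) ≠ 0 := (Real.rpow_pos_of_pos hd _).ne'
  have hM5 : 0 < M ^ (5 / 26 : ℝ) := Real.rpow_pos_of_pos hM _
  have e : d ^ (1 / 2 : ℝ) * M ^ (1 / 2 : ℝ) * (M ^ (3 / 13 : ℝ) / d ^ (3 / 13 : ℝ)) =
      (d ^ (1 / 2 : ℝ) / d ^ (3 / 13 : ℝ)) * (M ^ (1 / 2 : ℝ) * M ^ (3 / 13 : ℝ)) := by
    field_simp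
  rw [h1, h2, h3, e, ed, eM]
  have hle : d ^ (5 / 26 : ℝ) / M ^ (5 / 26 : ℝ) ≤ 1 := by
    rw [div_le_one hM5]
    exact Real.rpow_le_rpow hd.le hdM (by norm_num)
  calc d ^ (1 / 13 : ℝ) * d ^ (5 / 26 : ℝ) * (M ^ (12 / 13 : ℝ) / M ^ (5 / 26 : ℝ))
      = d ^ (1 / 13 : ℝ) * M ^ (12 / 13 : ℝ) * (d ^ (5 / 26 : ℝ) / M ^ (5 / 26 : ℝ)) := by ring
    _ ≤ d ^ (1 / 13 : ℝ) * M ^ (12 / 13 : ℝ) * 1 := by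
        apply mul_le_mul_of_nonneg_left hle; positivity
    _ = _ := mul_one _

/-- `M / Y₁ = d^{1/13} M^{12/13}` for `Y₁ = (M/d)^{1/13}`. [cite: Ngo2024, proof of Theorem 1.1] -/
theorem edge_term (hd : 0 < d) (hM : 0 < M) :
    M / (M / d) ^ (1 / 13 : ℝ) = d ^ (1 / 13 : ℝ) * M ^ (12 / 13 : ℝ) := by
  rw [Real.div_rpow hM.le hd.le, div_div_eq_mul_div, ← self_div_rpow13 hM]
  ring

/-- `1 ≤ d^{1/13} M^{12/13}` for `d, M ≥ 1`. [folklore] -/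
theorem one_le_dM (hd : 1 ≤ d) (hM : 1 ≤ M) : 1 ≤ d ^ (1 / 13 : ℝ) * M ^ (12 / 13 : ℝ) :=
  one_le_mul_of_one_le_of_one_le (Real.one_le_rpow hd (by norm_num)) (Real.one_le_rpow hM (by norm_num))

/-- `(d/M)^{1/13} M^{1+η} = d^{1/13} M^{12/13} · M^{η}`. [folklore] -/
theorem target_eq (hd : 0 < d) (hM : 0 < M) (η : ℝ) :
    (d / M) ^ (1 / 13 : ℝ) * M ^ (1 + η) = d ^ (1 / 13 : ℝ) * M ^ (12 / 13 : ℝ) * M ^ η := by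
  rw [Real.div_rpow hd.le hM.le, Real.rpow_add hM, Real.rpow_one, ← self_div_rpow13 hM]
  have hM13 : M ^ (1 / 13 : ℝ) ≠ 0 := (Real.rpow_pos_of_pos hM _).ne'
  field_simp

/-- `Y₁ = (M/d)^{1/13}` satisfies `1 ≤ Y₁ ≤ M` for `1 ≤ d ≤ M`. [folklore] -/
theorem Y₁_bounds (hd : 1 ≤ d) (hdM : d ≤ M) :
    1 ≤ (M / d) ^ (1 / 13 : ℝ) ∧ (M / d) ^ (1 / 13 : ℝ) ≤ M := by
  have hd0 : 0 < d := by linarith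
  have h1 : 1 ≤ M / d := by rw [le_div_iff₀ hd0]; linarith
  refine ⟨Real.one_le_rpow h1 (by norm_num), ?_⟩
  calc (M / d) ^ (1 / 13 : ℝ) ≤ (M / d) ^ (1 : ℝ) :=
        Real.rpow_le_rpow_of_exponent_le h1 (by norm_num)
    _ = M / d := Real.rpow_one _
    _ ≤ M := div_le_self (by linarith) hd

/-- In the range `8192 d ≤ M` the plateau parameter satisfies `Y₁ = (M/d)^{1/13} ≥ 2`
(`8192 = 2¹³`). [folklore] -/
theorem two_le_Y₁ (hd : 0 < d) (h : 8192 * d ≤ M) : 2 ≤ (M / d) ^ (1 / 13 : ℝ) := by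
  have h1 : (8192 : ℝ) ≤ M / d := by rw [le_div_iff₀ hd]; linarith
  have h2 : ((8192 : ℝ)) ^ (1 / 13 : ℝ) = 2 := by
    rw [show (8192 : ℝ) = (2 : ℝ) ^ (13 : ℕ) by norm_num, ← Real.rpow_natCast,
      ← Real.rpow_mul (by norm_num)]
    norm_num
  calc (2 : ℝ) = (8192 : ℝ) ^ (1 / 13 : ℝ) := h2.symm
    _ ≤ (M / d) ^ (1 / 13 : ℝ) := Real.rpow_le_rpow (by norm_num) h1 (by norm_num)

/-- In the complementary range `M < 8192 d`: `(d/M)^{1/13} ≥ 1/2`. [folklore] -/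
theorem half_le_rpow13 (hM : 0 < M) (h : M < 8192 * d) :
    1 / 2 ≤ (d / M) ^ (1 / 13 : ℝ) := by
  have h1 : (1 / 8192 : ℝ) ≤ d / M := by
    rw [div_le_div_iff₀ (by norm_num) hM]; linarith
  have h2 : ((1 / 8192 : ℝ)) ^ (1 / 13 : ℝ) = 1 / 2 := by
    rw [show (1 / 8192 : ℝ) = (1 / 2 : ℝ) ^ (13 : ℕ) by norm_num, ← Real.rpow_natCast,
      ← Real.rpow_mul (by norm_num)]
    norm_num
  calc (1 / 2 : ℝ) = (1 / 8192 : ℝ) ^ (1 / 13 : ℝ) := h2.symm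
    _ ≤ (d / M) ^ (1 / 13 : ℝ) := Real.rpow_le_rpow (by norm_num) h1 (by norm_num)

end powers

/-! ### The reduction -/

section reduction

variable {a b c : ℤ}

/-- Orbit representatives met by a Weyl sum are level forms at level `a` with `A ≠ 0`. [folklore] -/
theorem rep_qualifies (ha : 0 < a) (hΔ : 0 < discrim a b c) (hsq : ¬ IsSquare (discrim a b c))
    {d N : ℕ} {R : BinQF} (hR : R ∈ (levelFormsUpTo a b c d N).image (orbitRep a.toNat)) :
    IsLevelForm a b (discrim a b c) a.toNat R ∧ R.a ≠ 0 ∧ 0 < R.disc ∧ ¬ IsSquare R.disc := by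
  obtain ⟨Q₀, hQ₀, hRQ₀⟩ := Finset.mem_image.1 hR
  obtain ⟨hQ₀lev, -, -, -⟩ := (mem_levelFormsUpTo ha).1 hQ₀
  have hRQ : LevelEquiv a.toNat R Q₀ := hRQ₀ ▸ levelEquiv_orbitRep Q₀
  have hRlev : IsLevelForm a b (discrim a b c) a.toNat R :=
    isLevelForm_of_levelEquiv ha (isLevelForm_base hQ₀lev) hRQ
  have hRsq : ¬ IsSquare R.disc := by rw [hRlev.disc_eq]; exact hsq
  exact ⟨hRlev, a_ne_zero_of_not_isSquare hRsq, by rw [hRlev.disc_eq]; exact hΔ, hRsq⟩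

/-- **The uniform linear-form bound for `f = ax² + bx + c` (`a > 0`, `Δ > 0` irreducible data)
from the Poincaré-series bound** (hypothesis `HP`, the h-uniform form of Ngo's Proposition 3.18
for the Tóth sums with plateau weights): for every `ε > 0` the DFI shape
`‖L_d(M)‖ ≤ K (h,d)^{1/4} (d/M)^{1/13} M^{1 + ε/13}` in `d ≤ C₁M`, `h ≤ C₂dM`.
[cite: Ngo2024, §3.1 Lemma 3.1, §3.5 Corollary 3.19, proof of Theorem 1.1; Toth2000, main theorem] -/
theorem uniformLinearFormBound_of_tothPoincareBound (ha : 0 < a) (hΔ : 0 < discrim a b c)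
    (hsq : ¬ IsSquare (discrim a b c)) {Cρ : ℝ} (hCρ : 1 ≤ Cρ)
    (hρ : ∀ h : ℤ, ∀ n : ℕ, 1 ≤ n →
      ‖polyRootWeylSum (C a * X ^ 2 + C b * X + C c) n h‖ ≤ Cρ * (Nat.divisors n).card)
    (HP : ∀ R : BinQF, IsLevelForm a b (discrim a b c) a.toNat R → R.a ≠ 0 →
      ∀ g₁ : SL(2, ℤ), g₁ ∈ stabLevel R a.toNat → deckFactor R g₁ < 1 →
        (∀ s ∈ stabLevel R a.toNat, ∃ k : ℤ, s = g₁ ^ k ∨ s = -g₁ ^ k) →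
      ∀ m : ℤ, ∀ ε : ℝ, 0 < ε → ∀ Ch : ℝ, 0 < Ch → ∃ K : ℝ, 0 ≤ K ∧
        ∀ x Y₁ : ℝ, 2 ≤ Y₁ → Y₁ ≤ x → ∀ d : ℕ, 1 ≤ d → (d : ℝ) ^ 2 ≤ x →
          ∀ h : ℤ, h ≠ 0 → |(h : ℝ)| ≤ Ch * x →
          ‖∑' v : PrimVec a.toNat,
              weylWeightSL a b d ⌈3 * x⌉₊ h (fun n => (tothPlateau x Y₁ n : ℂ)) R v.toSL *
                (tothWeight R g₁ m v.toSL : ℂ)‖ ≤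
            K * ((Int.gcd h d : ℝ) ^ (1 / 4 : ℝ) * x ^ (3 / 4 : ℝ) * (d : ℝ) ^ (-(1 / 2) : ℝ) *
                  Y₁ ^ (9 / 4 : ℝ) + x ^ (1 / 2 : ℝ) * Y₁ ^ (3 : ℝ)) * (x * d * Y₁) ^ ε)
    (ε : ℝ) (hε : 0 < ε) :
    ∃ θ η γ : ℝ, 0 < θ ∧ θ ≤ 1 ∧ 0 ≤ η ∧ η < 2 * ε * θ ∧ 0 ≤ γ ∧
      ∀ C₁ C₂ : ℝ, 0 < C₁ → 0 < C₂ → ∃ K : ℝ,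
        ∀ h : ℕ, 1 ≤ h → ∀ d : ℕ, 1 ≤ d → ∀ M : ℝ, 1 ≤ M →
          (d : ℝ) ≤ C₁ * M → (h : ℝ) ≤ C₂ * d * M →
          ‖DFI1995.linearForm (C a * X ^ 2 + C b * X + C c) h d M‖ ≤
            K * (Nat.gcd h d : ℝ) ^ γ * ((d : ℝ) / M) ^ θ * M ^ (1 + η) := by
  classical
  refine ⟨1 / 13, ε / 13, 1 / 4, by norm_num, by norm_num, by positivity, by linarith, by norm_num,
    fun C₁ C₂ hC₁ hC₂ => ?_⟩
  -- a small exponent for the losses: `4 ε₀ ≤ ε/13`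
  obtain ⟨ε₀, hε₀def⟩ : ∃ ε₀ : ℝ, ε₀ = ε / 104 := ⟨_, rfl⟩
  have hε₀0 : 0 < ε₀ := by rw [hε₀def]; positivity
  have h4ε₀ : 4 * ε₀ ≤ ε / 13 := by rw [hε₀def]; linarith
  have h2ε₀ : 2 * ε₀ ≤ ε / 13 := by linarith
  have hCρ0 : 0 ≤ Cρ := by linarith
  -- divisor bound, representatives, generators, constants
  obtain ⟨Cτ, hCτ1, hτ⟩ := exists_card_divisors_le_mul_rpow hε₀0
  have hCτ0 : 0 ≤ Cτ := by linarith
  obtain ⟨S, hS⟩ := exists_repSet a ha (discrim a b c) hsq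
  haveI : NeZero a.toNat := ⟨by omega⟩
  let g : BinQF → SL(2, ℤ) := fun R =>
    if hR : R.a ≠ 0 ∧ 0 < R.disc ∧ ¬ IsSquare R.disc then
      Classical.choose (exists_deck_generator hR.1 hR.2.1 hR.2.2 a.toNat) else 1
  have hg : ∀ R : BinQF, (hR : R.a ≠ 0 ∧ 0 < R.disc ∧ ¬ IsSquare R.disc) →
      g R ∈ stabLevel R a.toNat ∧ deckFactor R (g R) < 1 ∧
        ∀ s ∈ stabLevel R a.toNat, ∃ k : ℤ, s = g R ^ k ∨ s = -g R ^ k := by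
    intro R hR
    simp only [g, dif_pos hR]
    exact Classical.choose_spec (exists_deck_generator hR.1 hR.2.1 hR.2.2 a.toNat)
  let Kf : BinQF → ℝ := fun R =>
    if hR : IsLevelForm a b (discrim a b c) a.toNat R ∧ (R.a ≠ 0 ∧ 0 < R.disc ∧ ¬ IsSquare R.disc) then
      Classical.choose (HP R hR.1 hR.2.1 (g R) (hg R hR.2).1 (hg R hR.2).2.1 (hg R hR.2).2.2 0 ε₀ hε₀0
        C₂ hC₂)
    else 0
  have hKf0 : ∀ R, 0 ≤ Kf R := by
    intro R; simp only [Kf]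
    split_ifs with hR
    · exact (Classical.choose_spec (HP R hR.1 hR.2.1 (g R) (hg R hR.2).1 (hg R hR.2).2.1
        (hg R hR.2).2.2 0 ε₀ hε₀0 C₂ hC₂)).1
    · exact le_rfl
  have hKf : ∀ R (hR : IsLevelForm a b (discrim a b c) a.toNat R ∧
      (R.a ≠ 0 ∧ 0 < R.disc ∧ ¬ IsSquare R.disc)),
      ∀ x Y₁ : ℝ, 2 ≤ Y₁ → Y₁ ≤ x → ∀ d : ℕ, 1 ≤ d → (d : ℝ) ^ 2 ≤ x →
        ∀ h : ℤ, h ≠ 0 → |(h : ℝ)| ≤ C₂ * x →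
        ‖∑' v : PrimVec a.toNat,
            weylWeightSL a b d ⌈3 * x⌉₊ h (fun n => (tothPlateau x Y₁ n : ℂ)) R v.toSL *
              (tothWeight R (g R) 0 v.toSL : ℂ)‖ ≤
          Kf R * ((Int.gcd h d : ℝ) ^ (1 / 4 : ℝ) * x ^ (3 / 4 : ℝ) * (d : ℝ) ^ (-(1 / 2) : ℝ) *
                Y₁ ^ (9 / 4 : ℝ) + x ^ (1 / 2 : ℝ) * Y₁ ^ (3 : ℝ)) * (x * d * Y₁) ^ ε₀ := by
    intro R hR
    simp only [Kf, dif_pos hR]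
    exact (Classical.choose_spec (HP R hR.1 hR.2.1 (g R) (hg R hR.2).1 (hg R hR.2).2.1
      (hg R hR.2).2.2 0 ε₀ hε₀0 C₂ hC₂)).2
  have hKsum0 : 0 ≤ ∑ R ∈ S, Kf R := Finset.sum_nonneg (fun R _ => hKf0 R)
  refine ⟨2 * (∑ R ∈ S, Kf R) + 12 * (3 : ℝ) ^ ε₀ * Cρ * Cτ + 4 * Cρ * Cτ * (2 * C₁) ^ ε₀, ?_⟩
  intro h hh d hd M hM hdC₁ hhC₂
  have hd0 : (0 : ℝ) < d := by exact_mod_cast hd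
  have hd1 : (1 : ℝ) ≤ d := by exact_mod_cast hd
  have hM0 : 0 < M := by linarith
  have hρh := hρ (h : ℤ)
  -- the common factors of the target are `≥ 1`
  have hgcd1 : 1 ≤ ((Nat.gcd h d : ℕ) : ℝ) ^ (1 / 4 : ℝ) := by
    apply Real.one_le_rpow _ (by norm_num)
    exact_mod_cast Nat.one_le_iff_ne_zero.2 (Nat.gcd_ne_zero_right (by omega))
  have h3pos : (0 : ℝ) ≤ 12 * (3 : ℝ) ^ ε₀ * Cρ * Cτ := by positivity
  have hC1pos : (0 : ℝ) ≤ 4 * Cρ * Cτ * (2 * C₁) ^ ε₀ := by positivity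
  obtain ⟨K, hKdef⟩ : ∃ K : ℝ, K = 2 * (∑ R ∈ S, Kf R) + 12 * (3 : ℝ) ^ ε₀ * Cρ * Cτ +
      4 * Cρ * Cτ * (2 * C₁) ^ ε₀ := ⟨_, rfl⟩
  rw [← hKdef]
  have hK0 : 0 ≤ K := by rw [hKdef]; positivity
  rcases le_or_gt ((8192 : ℝ) * d) M with hdM8 | hdM8
  · ----------------------------------------------------------------
    -- Case A: `8192 d ≤ M`, smoothing with `x = dM`, `Y₁ = (M/d)^{1/13} ≥ 2`
    ----------------------------------------------------------------
    have hdM : (d : ℝ) ≤ M := (le_mul_of_one_le_left hd0.le (by norm_num)).trans hdM8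
    obtain ⟨hY1, hYM⟩ := Y₁_bounds hd1 hdM
    have hY2 : 2 ≤ (M / d) ^ (1 / 13 : ℝ) := two_le_Y₁ hd0 hdM8
    have hdx : (d : ℝ) ^ 2 ≤ (d : ℝ) * M := by
      rw [sq]; exact mul_le_mul_of_nonneg_left hdM hd0.le
    have hx1 : M ≤ (d : ℝ) * M := le_mul_of_one_le_left hM0.le hd1
    have hYx : (M / d) ^ (1 / 13 : ℝ) ≤ (d : ℝ) * M := hYM.trans hx1
    have hY0 : 0 < (M / d) ^ (1 / 13 : ℝ) := by linarith
    have hN' : d * ⌊2 * M⌋₊ ≤ ⌈3 * ((d : ℝ) * M)⌉₊ := by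
      have h1 : ((d * ⌊2 * M⌋₊ : ℕ) : ℝ) ≤ 3 * ((d : ℝ) * M) := by
        push_cast
        have : (⌊2 * M⌋₊ : ℝ) ≤ 2 * M := Nat.floor_le (by linarith)
        calc (d : ℝ) * ⌊2 * M⌋₊ ≤ d * (2 * M) := mul_le_mul_of_nonneg_left this hd0.le
          _ ≤ 3 * ((d : ℝ) * M) := by linarith [mul_nonneg hd0.le hM0.le]
      exact_mod_cast h1.trans (Nat.le_ceil _)
    -- (i) smoothing
    have hsmooth := norm_linearForm_sub_smooth_le (C a * X ^ 2 + C b * X + C c) (h : ℤ) hd hM hY1 hN'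
    have hedge := edge_sum_le (ρ := fun n => polyRootWeylSum (C a * X ^ 2 + C b * X + C c) n h)
      hCρ0 hCτ0 hε₀0.le (hρh) hτ hd hM hY1 ⌈3 * ((d : ℝ) * M)⌉₊
    -- (ii) the smoothed sum as Tóth sums
    have hgReps : ∀ R ∈ (levelFormsUpTo a b c d ⌈3 * ((d : ℝ) * M)⌉₊).image (orbitRep a.toNat),
        g R ∈ stabLevel R a.toNat ∧ deckFactor R (g R) < 1 ∧
          ∀ s ∈ stabLevel R a.toNat, ∃ k : ℤ, s = g R ^ k ∨ s = -g R ^ k :=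
      fun R hR => hg R (rep_qualifies ha hΔ hsq hR).2
    have hTS := weylSum_eq_sum_tothSum (d := d) (N := ⌈3 * ((d : ℝ) * M)⌉₊) ha hΔ hsq (h : ℤ)
      (fun n => (tothPlateau ((d : ℝ) * M) ((M / d) ^ (1 / 13 : ℝ)) n : ℂ)) (fun _ => 0) g hgReps
    -- (iii) bound for the smoothed sum
    obtain ⟨G4, hG4def⟩ : ∃ G4 : ℝ, G4 = ((Nat.gcd h d : ℕ) : ℝ) ^ (1 / 4 : ℝ) := ⟨_, rfl⟩
    have hG41 : 1 ≤ G4 := by rw [hG4def]; exact hgcd1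
    have hG40 : 0 ≤ G4 := zero_le_one.trans hG41
    have hgcdZ : ((Int.gcd (h : ℤ) d : ℕ) : ℝ) ^ (1 / 4 : ℝ) = G4 := by
      rw [hG4def, Int.gcd_natCast_natCast]
    obtain ⟨B, hBdef⟩ : ∃ B : ℝ, B = (G4 * ((d : ℝ) * M) ^ (3 / 4 : ℝ) *
        (d : ℝ) ^ (-(1 / 2) : ℝ) * ((M / d) ^ (1 / 13 : ℝ)) ^ (9 / 4 : ℝ) +
        ((d : ℝ) * M) ^ (1 / 2 : ℝ) * ((M / d) ^ (1 / 13 : ℝ)) ^ (3 : ℝ)) *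
        (((d : ℝ) * M) * d * (M / d) ^ (1 / 13 : ℝ)) ^ ε₀ := ⟨_, rfl⟩
    have hB0 : 0 ≤ B := by rw [hBdef]; positivity
    have hsm : ‖∑ n ∈ (Finset.Icc 1 ⌈3 * ((d : ℝ) * M)⌉₊).filter (d ∣ ·),
        (tothPlateau ((d : ℝ) * M) ((M / d) ^ (1 / 13 : ℝ)) n : ℂ) *
          polyRootWeylSum (C a * X ^ 2 + C b * X + C c) n h‖ ≤ (∑ R ∈ S, Kf R) * B := by
      rw [hTS]
      refine (norm_sum_le _ _).trans ?_
      have hterm : ∀ R ∈ (levelFormsUpTo a b c d ⌈3 * ((d : ℝ) * M)⌉₊).image (orbitRep a.toNat),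
          ‖(1 / 2 : ℂ) * ∑' v : PrimVec a.toNat,
              weylWeightSL a b d ⌈3 * ((d : ℝ) * M)⌉₊ h
                (fun n => (tothPlateau ((d : ℝ) * M) ((M / d) ^ (1 / 13 : ℝ)) n : ℂ)) R v.toSL *
              (tothWeight R (g R) 0 v.toSL : ℂ)‖ ≤ Kf R * B := by
        intro R hR
        have hq := rep_qualifies ha hΔ hsq hR
        have hh0 : ((h : ℤ)) ≠ 0 := by exact_mod_cast (show h ≠ 0 by omega)
        have hhx : |((h : ℤ) : ℝ)| ≤ C₂ * ((d : ℝ) * M) := by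
          rw [Int.cast_natCast, abs_of_nonneg (Nat.cast_nonneg _)]
          linarith
        have hT := hKf R ⟨hq.1, hq.2⟩ ((d : ℝ) * M) ((M / d) ^ (1 / 13 : ℝ)) hY2 hYx d hd hdx
          (h : ℤ) hh0 hhx
        rw [hgcdZ, mul_assoc, ← hBdef] at hT
        rw [norm_mul]
        calc ‖(1 / 2 : ℂ)‖ * _ ≤ 1 * (Kf R * B) :=
              mul_le_mul (by norm_num) hT (norm_nonneg _) zero_le_one
          _ = Kf R * B := one_mul _
      calc ∑ R ∈ (levelFormsUpTo a b c d ⌈3 * ((d : ℝ) * M)⌉₊).image (orbitRep a.toNat), _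
          ≤ ∑ R ∈ (levelFormsUpTo a b c d ⌈3 * ((d : ℝ) * M)⌉₊).image (orbitRep a.toNat), Kf R * B :=
            Finset.sum_le_sum hterm
        _ ≤ ∑ R ∈ S, Kf R * B := by
            apply Finset.sum_le_sum_of_subset_of_nonneg (image_orbitRep_subset ha hS)
            intro R _ _; exact mul_nonneg (hKf0 R) hB0
        _ = (∑ R ∈ S, Kf R) * B := by rw [Finset.sum_mul]
    -- (iv) `B ≤ 2 (h,d)^{1/4} Q M^{4ε₀}`, `Q = d^{1/13} M^{12/13}`
    obtain ⟨Q, hQdef⟩ : ∃ Q : ℝ, Q = (d : ℝ) ^ (1 / 13 : ℝ) * M ^ (12 / 13 : ℝ) := ⟨_, rfl⟩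
    have hQ1 : 1 ≤ Q := by rw [hQdef]; exact one_le_dM hd1 hM
    have hQ0 : 0 ≤ Q := zero_le_one.trans hQ1
    have hM4 : ∀ t : ℝ, 0 ≤ t → t ≤ M ^ (4 : ℕ) → t ^ ε₀ ≤ M ^ (4 * ε₀) := by
      intro t ht0 ht
      calc t ^ ε₀ ≤ (M ^ (4 : ℕ)) ^ ε₀ := Real.rpow_le_rpow ht0 ht hε₀0.le
        _ = M ^ (4 * ε₀) := by rw [← Real.rpow_natCast, ← Real.rpow_mul hM0.le]; norm_num
    have hMpow : (((d : ℝ) * M) * d * (M / d) ^ (1 / 13 : ℝ)) ^ ε₀ ≤ M ^ (4 * ε₀) := by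
      apply hM4 _ (by positivity)
      have h1 : ((d : ℝ) * M) * d * (M / d) ^ (1 / 13 : ℝ) ≤ (M * M) * M * M := by
        apply mul_le_mul _ hYM hY0.le (by positivity)
        apply mul_le_mul _ hdM hd0.le (by positivity)
        exact mul_le_mul_of_nonneg_right hdM hM0.le
      calc _ ≤ (M * M) * M * M := h1
        _ = M ^ (4 : ℕ) := by ring
    have hMe0 : 0 ≤ M ^ (4 * ε₀) := Real.rpow_nonneg hM0.le _
    have hB : B ≤ 2 * G4 * Q * M ^ (4 * ε₀) := by
      have e1 : G4 * ((d : ℝ) * M) ^ (3 / 4 : ℝ) * (d : ℝ) ^ (-(1 / 2) : ℝ) *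
          ((M / d) ^ (1 / 13 : ℝ)) ^ (9 / 4 : ℝ) = G4 * Q := by
        rw [hQdef, ← main_term_one hd0 hM0]; ring
      have e2 : ((d : ℝ) * M) ^ (1 / 2 : ℝ) * ((M / d) ^ (1 / 13 : ℝ)) ^ (3 : ℝ) ≤ G4 * Q := by
        calc _ ≤ Q := by rw [hQdef]; exact main_term_two hd0 hdM
          _ = 1 * Q := (one_mul _).symm
          _ ≤ _ := mul_le_mul_of_nonneg_right hG41 hQ0
      rw [hBdef, e1]
      calc (G4 * Q + ((d : ℝ) * M) ^ (1 / 2 : ℝ) * ((M / d) ^ (1 / 13 : ℝ)) ^ (3 : ℝ)) *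
            (((d : ℝ) * M) * d * (M / d) ^ (1 / 13 : ℝ)) ^ ε₀
          ≤ (G4 * Q + G4 * Q) * M ^ (4 * ε₀) :=
            mul_le_mul (by linarith) hMpow (by positivity) (by positivity)
        _ = _ := by ring
    -- (v) the edge
    have hedge' : 2 * (M / (M / d) ^ (1 / 13 : ℝ) + 1) * (Cρ * Cτ * (3 * d * M) ^ ε₀) ≤
        4 * (3 : ℝ) ^ ε₀ * Cρ * Cτ * Q * M ^ (4 * ε₀) := by
      rw [edge_term hd0 hM0, ← hQdef]
      have h1 : (3 * (d : ℝ) * M) ^ ε₀ ≤ (3 : ℝ) ^ ε₀ * M ^ (4 * ε₀) := by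
        have : (3 * (d : ℝ) * M) ^ ε₀ = (3 : ℝ) ^ ε₀ * ((d : ℝ) * M) ^ ε₀ := by
          rw [mul_assoc, Real.mul_rpow (by norm_num) (by positivity)]
        rw [this]
        apply mul_le_mul_of_nonneg_left _ (by positivity)
        apply hM4 _ (by positivity)
        have : (d : ℝ) * M ≤ M * M := mul_le_mul_of_nonneg_right hdM hM0.le
        calc (d : ℝ) * M ≤ M * M := this
          _ = M ^ (2 : ℕ) := by ring
          _ ≤ M ^ (4 : ℕ) := pow_le_pow_right₀ hM (by norm_num)
      have h2 : Q + 1 ≤ 2 * Q := by linarith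
      calc 2 * (Q + 1) * (Cρ * Cτ * (3 * d * M) ^ ε₀)
          ≤ 2 * (2 * Q) * (Cρ * Cτ * ((3 : ℝ) ^ ε₀ * M ^ (4 * ε₀))) := by
            apply mul_le_mul (by linarith) _ (by positivity) (by positivity)
            exact mul_le_mul_of_nonneg_left h1 (by positivity)
        _ = _ := by ring
    -- (vi) assemble
    have hL : ‖DFI1995.linearForm (C a * X ^ 2 + C b * X + C c) h d M‖ ≤
        (2 * (∑ R ∈ S, Kf R) + 12 * (3 : ℝ) ^ ε₀ * Cρ * Cτ) * (G4 * Q * M ^ (4 * ε₀)) := by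
      have h1 : ∀ (Lz Smz : ℂ), ‖Lz‖ ≤ ‖Smz‖ + ‖Lz - Smz‖ := by
        intro Lz Smz
        have := norm_add_le Smz (Lz - Smz); rwa [add_sub_cancel] at this
      have h2 := hsmooth.trans (hedge.trans hedge')
      have h3 := hsm.trans (mul_le_mul_of_nonneg_left hB hKsum0)
      have hX : 0 ≤ (3 : ℝ) ^ ε₀ * Cρ * Cτ * Q * M ^ (4 * ε₀) := by positivity
      have h4 : 4 * (3 : ℝ) ^ ε₀ * Cρ * Cτ * Q * M ^ (4 * ε₀) ≤
          12 * (3 : ℝ) ^ ε₀ * Cρ * Cτ * (G4 * Q * M ^ (4 * ε₀)) := by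
        calc 4 * (3 : ℝ) ^ ε₀ * Cρ * Cτ * Q * M ^ (4 * ε₀)
            = 4 * (1 * ((3 : ℝ) ^ ε₀ * Cρ * Cτ * Q * M ^ (4 * ε₀))) := by ring
          _ ≤ 12 * (G4 * ((3 : ℝ) ^ ε₀ * Cρ * Cτ * Q * M ^ (4 * ε₀))) :=
              mul_le_mul (by norm_num) (mul_le_mul_of_nonneg_right hG41 hX) (by positivity)
                (by norm_num)
          _ = _ := by ring
      calc _ ≤ _ := h1 _ _
        _ ≤ (∑ R ∈ S, Kf R) * (2 * G4 * Q * M ^ (4 * ε₀)) +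
              4 * (3 : ℝ) ^ ε₀ * Cρ * Cτ * Q * M ^ (4 * ε₀) := add_le_add h3 h2
        _ ≤ (∑ R ∈ S, Kf R) * (2 * G4 * Q * M ^ (4 * ε₀)) +
              12 * (3 : ℝ) ^ ε₀ * Cρ * Cτ * (G4 * Q * M ^ (4 * ε₀)) := by linarith
        _ = _ := by ring
    -- (vii) the target
    have htarget : K * ((Nat.gcd h d : ℕ) : ℝ) ^ (1 / 4 : ℝ) * ((d : ℝ) / M) ^ (1 / 13 : ℝ) *
        M ^ (1 + ε / 13) = K * (G4 * Q * M ^ (ε / 13)) := by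
      rw [← hG4def, mul_assoc (K * G4), target_eq hd0 hM0, ← hQdef]; ring
    rw [htarget]
    have hmono : G4 * Q * M ^ (4 * ε₀) ≤ G4 * Q * M ^ (ε / 13) :=
      mul_le_mul_of_nonneg_left (Real.rpow_le_rpow_of_exponent_le hM h4ε₀) (mul_nonneg hG40 hQ0)
    have hcoef : 2 * (∑ R ∈ S, Kf R) + 12 * (3 : ℝ) ^ ε₀ * Cρ * Cτ ≤ K := by
      rw [hKdef]; linarith
    exact hL.trans (mul_le_mul hcoef hmono (by positivity) hK0)
  · ----------------------------------------------------------------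
    -- Case B: `M < 8192 d`, `d ≤ C₁ M`, trivial bound
    ----------------------------------------------------------------
    have htriv := norm_linearForm_le_trivial (f := C a * X ^ 2 + C b * X + C c) (h := (h : ℤ))
      hCρ0 hCτ0 hε₀0.le hρh hτ hd hM
    have h1 : (2 * (d : ℝ) * M) ^ ε₀ ≤ (2 * C₁) ^ ε₀ * M ^ (2 * ε₀) := by
      have hle : 2 * (d : ℝ) * M ≤ (2 * C₁) * M ^ (2 : ℕ) := by
        calc 2 * (d : ℝ) * M = (2 * M) * d := by ring
          _ ≤ (2 * M) * (C₁ * M) := mul_le_mul_of_nonneg_left hdC₁ (by positivity)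
          _ = (2 * C₁) * M ^ (2 : ℕ) := by ring
      calc (2 * (d : ℝ) * M) ^ ε₀ ≤ ((2 * C₁) * M ^ (2 : ℕ)) ^ ε₀ :=
            Real.rpow_le_rpow (by positivity) hle hε₀0.le
        _ = (2 * C₁) ^ ε₀ * (M ^ (2 : ℕ)) ^ ε₀ := Real.mul_rpow (by positivity) (by positivity)
        _ = (2 * C₁) ^ ε₀ * M ^ (2 * ε₀) := by
            rw [← Real.rpow_natCast, ← Real.rpow_mul hM0.le]; norm_num
    have h2 : ‖DFI1995.linearForm (C a * X ^ 2 + C b * X + C c) h d M‖ ≤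
        2 * Cρ * Cτ * (2 * C₁) ^ ε₀ * M ^ (1 + 2 * ε₀) := by
      have e : M * M ^ (2 * ε₀) = M ^ (1 + 2 * ε₀) := by
        rw [Real.rpow_add hM0, Real.rpow_one]
      calc ‖DFI1995.linearForm (C a * X ^ 2 + C b * X + C c) h d M‖
          ≤ 2 * M * (Cρ * Cτ * (2 * d * M) ^ ε₀) := htriv
        _ ≤ 2 * M * (Cρ * Cτ * ((2 * C₁) ^ ε₀ * M ^ (2 * ε₀))) := by
            apply mul_le_mul_of_nonneg_left _ (by positivity)
            exact mul_le_mul_of_nonneg_left h1 (by positivity)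
        _ = 2 * Cρ * Cτ * (2 * C₁) ^ ε₀ * (M * M ^ (2 * ε₀)) := by ring
        _ = _ := by rw [e]
    have h3 : M ^ (1 + 2 * ε₀) ≤ M ^ (1 + ε / 13) :=
      Real.rpow_le_rpow_of_exponent_le hM (by linarith)
    have h4 : 1 / 2 ≤ ((d : ℝ) / M) ^ (1 / 13 : ℝ) := half_le_rpow13 hM0 hdM8
    have hcoef : 2 * (2 * Cρ * Cτ * (2 * C₁) ^ ε₀) ≤ K := by rw [hKdef]; linarith
    have hX0 : 0 ≤ 2 * Cρ * Cτ * (2 * C₁) ^ ε₀ := by positivity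
    calc ‖DFI1995.linearForm (C a * X ^ 2 + C b * X + C c) h d M‖
        ≤ 2 * Cρ * Cτ * (2 * C₁) ^ ε₀ * M ^ (1 + 2 * ε₀) := h2
      _ ≤ 2 * Cρ * Cτ * (2 * C₁) ^ ε₀ * M ^ (1 + ε / 13) :=
          mul_le_mul_of_nonneg_left h3 hX0
      _ = 2 * (2 * Cρ * Cτ * (2 * C₁) ^ ε₀) * 1 * (1 / 2) * M ^ (1 + ε / 13) := by ring
      _ ≤ K * ((Nat.gcd h d : ℕ) : ℝ) ^ (1 / 4 : ℝ) * ((d : ℝ) / M) ^ (1 / 13 : ℝ) * M ^ (1 + ε / 13) := by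
          apply mul_le_mul_of_nonneg_right _ (Real.rpow_nonneg hM0.le _)
          exact mul_le_mul (mul_le_mul hcoef hgcd1 zero_le_one hK0) h4 (by norm_num)
            (by positivity)

/-- **Tóth's theorem from the Poincaré-series bound.**  If for every `f = ax² + bx + c` with
`a > 0` and non-square `Δ > 0` the Tóth sums with plateau weights satisfy the h-uniform
Poincaré-series bound `HP` (Ngo's Proposition 3.18 / Corollary 3.19 shape, i.e. Poisson summation
+ Pitt's bound for sums of Kloosterman sums on `Γ₀(q)`, arXiv:2107.13301 Theorem 2.5, applied to
the weights with the exact phase of Corollary 3.14), then the roots of every irreducible integer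
quadratic of positive discriminant are equidistributed to prime moduli
(`toth2000_quadraticRoots_primeModuli`).  Everything else — the DFI sieve (Theorem 5), the
reduction to the uniform linear-form bound (`…TothCauchy`), the roots ↔ forms correspondence and
level structure (`QuadraticRootsLevel*`), Tóth's partition of unity and unfolding
(`…TothPartition/Unfold/WeylSum`), the smoothing and the bookkeeping of this file — is proved.
[cite: Toth2000, main theorem; Ngo2024, §3.5 Proposition 3.18–Corollary 3.19; DukeFriedlanderIwaniec1995, Theorem 5 p. 437] -/
theorem toth2000_quadraticRoots_primeModuli_of_tothPoincareBound
    (HP : ∀ a b c : ℤ, 0 < a → 0 < discrim a b c → ¬ IsSquare (discrim a b c) →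
      ∀ R : BinQF, IsLevelForm a b (discrim a b c) a.toNat R → R.a ≠ 0 →
      ∀ g₁ : SL(2, ℤ), g₁ ∈ stabLevel R a.toNat → deckFactor R g₁ < 1 →
        (∀ s ∈ stabLevel R a.toNat, ∃ k : ℤ, s = g₁ ^ k ∨ s = -g₁ ^ k) →
      ∀ m : ℤ, ∀ ε : ℝ, 0 < ε → ∀ Ch : ℝ, 0 < Ch → ∃ K : ℝ, 0 ≤ K ∧
        ∀ x Y₁ : ℝ, 2 ≤ Y₁ → Y₁ ≤ x → ∀ d : ℕ, 1 ≤ d → (d : ℝ) ^ 2 ≤ x →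
          ∀ h : ℤ, h ≠ 0 → |(h : ℝ)| ≤ Ch * x →
          ‖∑' v : PrimVec a.toNat,
              weylWeightSL a b d ⌈3 * x⌉₊ h (fun n => (tothPlateau x Y₁ n : ℂ)) R v.toSL *
                (tothWeight R g₁ m v.toSL : ℂ)‖ ≤
            K * ((Int.gcd h d : ℝ) ^ (1 / 4 : ℝ) * x ^ (3 / 4 : ℝ) * (d : ℝ) ^ (-(1 / 2) : ℝ) *
                  Y₁ ^ (9 / 4 : ℝ) + x ^ (1 / 2 : ℝ) * Y₁ ^ (3 : ℝ)) * (x * d * Y₁) ^ ε) :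
    toth2000_quadraticRoots_primeModuli := by
  refine toth2000_quadraticRoots_primeModuli_of_uniformLinearFormBound
    fun f hf hirr hΔ ε hε _ => ?_
  obtain ⟨Cρ, hCρ, hρ⟩ := exists_norm_polyRootWeylSum_le_of_irreducible hf hirr
  have hsqf := not_isSquare_discrim_of_irreducible hf hirr
  have hquad := eq_quad_of_natDegree_le_two f (by rw [hf])
  have ha0 : f.coeff 2 ≠ 0 := by
    rw [← hf]; exact leadingCoeff_ne_zero.2 hirr.ne_zero
  rcases lt_or_gt_of_ne ha0 with hneg | hpos
  · -- `a < 0`: work with `−f = (−a)x² + (−b)x + (−c)`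
    have ha' : 0 < -f.coeff 2 := neg_pos.2 hneg
    have hΔ' : 0 < discrim (-f.coeff 2) (-f.coeff 1) (-f.coeff 0) := by rw [discrim_neg]; exact hΔ
    have hsq' : ¬ IsSquare (discrim (-f.coeff 2) (-f.coeff 1) (-f.coeff 0)) := by
      rw [discrim_neg]; exact hsqf
    have hpoly : C (-f.coeff 2) * X ^ 2 + C (-f.coeff 1) * X + C (-f.coeff 0) = -f := by
      rw [← neg_quad, hquad]
    have hρ' : ∀ h : ℤ, ∀ n : ℕ, 1 ≤ n →
        ‖polyRootWeylSum (C (-f.coeff 2) * X ^ 2 + C (-f.coeff 1) * X + C (-f.coeff 0)) n h‖ ≤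
          Cρ * (Nat.divisors n).card := by
      intro h n hn
      rw [hpoly, polyRootWeylSum_neg_poly]
      exact hρ h n hn
    obtain ⟨θ, η, γ, h1, h2, h3, h4, h5, hK⟩ :=
      uniformLinearFormBound_of_tothPoincareBound ha' hΔ' hsq' hCρ hρ'
        (HP (-f.coeff 2) (-f.coeff 1) (-f.coeff 0) ha' hΔ' hsq') ε hε
    refine ⟨θ, η, γ, h1, h2, h3, h4, h5, fun C₁ C₂ hC₁ hC₂ => ?_⟩
    obtain ⟨K, hK⟩ := hK C₁ C₂ hC₁ hC₂
    refine ⟨K, fun h hh d hd M hM hdM hhM => ?_⟩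
    have e : DFI1995.linearForm f h d M =
        DFI1995.linearForm (C (-f.coeff 2) * X ^ 2 + C (-f.coeff 1) * X + C (-f.coeff 0)) h d M := by
      unfold DFI1995.linearForm
      refine Finset.sum_congr rfl fun m _ => ?_
      rw [hpoly, polyRootWeylSum_neg_poly]
    rw [e]
    exact hK h hh d hd M hM hdM hhM
  · -- `a > 0`
    obtain ⟨θ, η, γ, h1, h2, h3, h4, h5, hK⟩ :=
      uniformLinearFormBound_of_tothPoincareBound hpos hΔ hsqf hCρ
        (fun h n hn => by rw [hquad]; exact hρ h n hn)
        (HP (f.coeff 2) (f.coeff 1) (f.coeff 0) hpos hΔ hsqf) ε hε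
    refine ⟨θ, η, γ, h1, h2, h3, h4, h5, fun C₁ C₂ hC₁ hC₂ => ?_⟩
    obtain ⟨K, hK⟩ := hK C₁ C₂ hC₁ hC₂
    refine ⟨K, fun h hh d hd M hM hdM hhM => ?_⟩
    have e : DFI1995.linearForm f h d M =
        DFI1995.linearForm (C (f.coeff 2) * X ^ 2 + C (f.coeff 1) * X + C (f.coeff 0)) h d M := by
      rw [hquad]
    rw [e]
    exact hK h hh d hd M hM hdM hhM

end reduction

end RootForms

end Literature.NumberTheory.Sieve

/-!
## Part 2. Derivative bounds for the plateau weights of the Tóth sums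

Topic `Literature/NumberTheory/Sieve`, a support file for the analysis of the hypothesis of
`…TothReduction.toth2000_quadraticRoots_primeModuli_of_tothPoincareBound` (Poisson summation in
T. Ngo, arXiv:2107.13301, §3.5–3.6).  Ngo's weight `g` is "smooth and compactly supported in
`[x − x/Y₁, 2x + x/Y₁]`, equal to `1` on `[x, 2x]`, with `‖g^{(j)}‖_∞ ≪_j (Y₁/x)^j`" (§3.1); the
tree's explicit choice is `tothPlateau x Y₁ t = ζ((t − (x − x/Y₁)) Y₁/x) ζ((2x + x/Y₁ − t) Y₁/x)`,
`ζ = Real.smoothTransition`.  This part proves the derivative bounds (every derivative of `ζ` is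
bounded: `Polymath8a.exists_bound_iteratedDeriv_smoothTransition`, imported):

* `iteratedDeriv_comp_affine` — `(f(λt + μ))^{(j)} = λ^j f^{(j)}(λt + μ)`;
* **`exists_bound_iteratedDeriv_tothPlateau`** — `|∂_t^j G_{x,Y₁}(t)| ≤ C_j (Y₁/x)^j` uniformly in
  `x, Y₁ > 0` and `t` (Leibniz rule).

## References

* T. Ngo, *On roots of quadratic congruences*, arXiv:2107.13301, §3.1 (the weight `g` and its
  derivative bounds), §3.6 Lemma 3.20. [cite: Ngo2024, §3.1, §3.6 Lemma 3.20]
* Á. Tóth, *Roots of quadratic congruences*, IMRN 2000. [cite: Toth2000, main theorem]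
-/

noncomputable section

namespace Literature.NumberTheory.Sieve

namespace RootForms

open Real

-- (Every derivative of `ζ = Real.smoothTransition` is bounded:
-- `Polymath8a.exists_bound_iteratedDeriv_smoothTransition` of `Polymath8aPartitionOfUnity.lean`.)

/-! ### Affine changes of variable -/

/-- `(f(λt + μ))^{(j)}(t) = λ^j f^{(j)}(λt + μ)` for smooth `f`. [folklore] -/
theorem iteratedDeriv_comp_affine {f : ℝ → ℝ} (hf : ContDiff ℝ (⊤ : ℕ∞) f) (c μ : ℝ) (j : ℕ) (t : ℝ) :
    iteratedDeriv j (fun s => f (c * s + μ)) t = c ^ j * iteratedDeriv j f (c * t + μ) := by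
  have h1 : (fun s => f (c * s + μ)) = fun s => (fun u => f (u + μ)) (c * s) := rfl
  have hfj : ContDiff ℝ j f := hf.of_le (by exact_mod_cast le_top)
  have hF : ContDiff ℝ j (fun u => f (u + μ)) := hfj.comp (contDiff_id.add contDiff_const)
  rw [h1, iteratedDeriv_comp_const_mul hF c]
  simp only
  rw [iteratedDeriv_comp_add_const]

/-- A factor `ζ(λt + μ)` of the plateau: `|∂^j| ≤ C_j |λ|^j`. [cite: Ngo2024, §3.1] -/
theorem abs_iteratedDeriv_transition_affine_le {j : ℕ} {C : ℝ}
    (hC : ∀ s : ℝ, |iteratedDeriv j Real.smoothTransition s| ≤ C) (c μ t : ℝ) :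
    |iteratedDeriv j (fun s => Real.smoothTransition (c * s + μ)) t| ≤ C * |c| ^ j := by
  rw [iteratedDeriv_comp_affine (Real.smoothTransition.contDiff (n := ⊤)) c μ j t, abs_mul, abs_pow,
    mul_comm]
  exact mul_le_mul_of_nonneg_right (hC _) (pow_nonneg (abs_nonneg _) _)

/-! ### The plateau -/

/-- The plateau as a product of two affine transitions. [folklore] -/
theorem tothPlateau_eq_mul (x Y₁ : ℝ) :
    tothPlateau x Y₁ = (fun t => Real.smoothTransition (Y₁ / x * t + -((x - x / Y₁) * (Y₁ / x)))) *
      (fun t => Real.smoothTransition (-(Y₁ / x) * t + (2 * x + x / Y₁) * (Y₁ / x))) := by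
  funext t
  simp only [tothPlateau, Pi.mul_apply]
  congr 1
  · congr 1; ring
  · congr 1; ring

/-- Each factor is smooth. [folklore] -/
theorem contDiff_transition_affine (c μ : ℝ) (n : ℕ) :
    ContDiff ℝ n (fun s : ℝ => Real.smoothTransition (c * s + μ)) :=
  (Real.smoothTransition.contDiff (n := n)).comp ((contDiff_const.mul contDiff_id).add contDiff_const)

/-- **Derivative bounds for the plateau**: for every `j` there is `C_j` with
`|∂_t^j G_{x,Y₁}(t)| ≤ C_j (Y₁/x)^j` for all `x, Y₁ > 0` and all `t` (Leibniz rule on the two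
affine transitions). [cite: Ngo2024, §3.1 (`‖g^{(j)}‖_∞ ≪_j (Y₁/x)^j`), §3.6 Lemma 3.20] -/
theorem exists_bound_iteratedDeriv_tothPlateau (j : ℕ) :
    ∃ C : ℝ, 0 ≤ C ∧ ∀ x Y₁ : ℝ, 0 < x → 0 < Y₁ → ∀ t : ℝ,
      |iteratedDeriv j (tothPlateau x Y₁) t| ≤ C * (Y₁ / x) ^ j := by
  -- bounds for all orders up to `j`
  have hb : ∀ i : ℕ, ∃ C : ℝ, 0 ≤ C ∧ ∀ s : ℝ, |iteratedDeriv i Real.smoothTransition s| ≤ C :=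
    fun i => Polymath8a.exists_bound_iteratedDeriv_smoothTransition i
  choose Cb hCb0 hCb using hb
  refine ⟨∑ i ∈ Finset.range (j + 1), (j.choose i : ℝ) * Cb i * Cb (j - i),
    Finset.sum_nonneg (fun i _ => by have := hCb0 i; have := hCb0 (j - i); positivity), ?_⟩
  intro x Y₁ hx hY t
  set c : ℝ := Y₁ / x with hc
  have hc0 : 0 < c := div_pos hY hx
  set F₁ : ℝ → ℝ := fun s => Real.smoothTransition (c * s + -((x - x / Y₁) * c)) with hF₁
  set F₂ : ℝ → ℝ := fun s => Real.smoothTransition (-c * s + (2 * x + x / Y₁) * c) with hF₂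
  have hprod : tothPlateau x Y₁ = F₁ * F₂ := by rw [tothPlateau_eq_mul]
  have h1 : ∀ i s, |iteratedDeriv i F₁ s| ≤ Cb i * c ^ i := by
    intro i s
    have := abs_iteratedDeriv_transition_affine_le (hCb i) c (-((x - x / Y₁) * c)) s
    rwa [abs_of_pos hc0] at this
  have h2 : ∀ i s, |iteratedDeriv i F₂ s| ≤ Cb i * c ^ i := by
    intro i s
    have := abs_iteratedDeriv_transition_affine_le (hCb i) (-c) ((2 * x + x / Y₁) * c) s
    rwa [abs_neg, abs_of_pos hc0] at this
  rw [hprod, iteratedDeriv_mul (contDiff_transition_affine _ _ j).contDiffAt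
    (contDiff_transition_affine _ _ j).contDiffAt]
  refine (Finset.abs_sum_le_sum_abs _ _).trans ?_
  rw [Finset.sum_mul]
  refine Finset.sum_le_sum fun i hi => ?_
  rw [Finset.mem_range] at hi
  rw [abs_mul, abs_mul, Nat.abs_cast]
  calc (j.choose i : ℝ) * |iteratedDeriv i F₁ t| * |iteratedDeriv (j - i) F₂ t|
      ≤ (j.choose i : ℝ) * (Cb i * c ^ i) * (Cb (j - i) * c ^ (j - i)) := by
        apply mul_le_mul (mul_le_mul_of_nonneg_left (h1 i t) (Nat.cast_nonneg _)) (h2 (j - i) t)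
          (abs_nonneg _)
        exact mul_nonneg (Nat.cast_nonneg _) (mul_nonneg (hCb0 i) (pow_nonneg hc0.le _))
    _ = (j.choose i : ℝ) * Cb i * Cb (j - i) * (c ^ i * c ^ (j - i)) := by ring
    _ = (j.choose i : ℝ) * Cb i * Cb (j - i) * c ^ j := by
        rw [← pow_add, Nat.add_sub_cancel' (by omega)]

end RootForms

end Literature.NumberTheory.Sieve
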